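import Literature.AnabelianGeometry.AbsoluteAnabelian.GaloisSectionsFacts
import Mathlib.Topology.Instances.ZMod
import HarnessLib

/-!
# [GalSect] Thm. 1.3 (ii), Lem. 3.1, Cor. 3.2 as typed in `GaloisSectionsFacts.lean` are SCHEMATA:
# their universal closures are refutable (FACT-LIST F-0103 / F-0101 / F-0100)

S. Mochizuki, *Galois sections in absolute anabelian geometry*, Nagoya Math. J. 179 (2005) 17–45
[MochizukiGalSect2005]; kurims manuscript pages (lit key `paper:url-1b7afe4e6889`): Thm. 1.3 (ii) p. 6,
Lem. 3.1 p. 13, Cor. 3.2 p. 14.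

PROOF-ONLY negative-knowledge companion (no definition, no instance, no structure) of
`GaloisSectionsFacts.lean` (abc-iut-L4-t16), cell abc-iut, seat abc-iut-f-096 (FACT-LIST rows
**F-0103** `GalSect.Thm_1_3_ii_cusps`, **F-0101** `GalSect.Lem_3_1_i_iff_iv`, **F-0100** `GalSect.Cor_3_2`;
class `preparatory`, kernel_closedness `parametrised`).

The three declarations are typed (policy θ, shape (1)) as PREDICATES on abstract group data — cuspidal
data `C : E.CuspidalData`, point data `P : GalSect.PointData E` over an arbitrary extension of profinite
groups `E : FundamentalExtension` — and the typing file says so itself ("junk data only falsify their own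
instance").  A predicate on free data has no `_holds` witness: this file records the elementary kernel
objects showing that each UNIVERSAL CLOSURE is false, so that none of the three rows can be mistaken for
a closed fact or enter a conditional certificate as a universally quantified hypothesis binder (which
would make the certificate vacuous):

* `not_thm_1_3_ii_cusps_of_dcusp_eq_bot` / `not_forall_thm_1_3_ii_cusps` — a cusp whose chosen
  decomposition group is trivial inside a nontrivial `Π` is not commensurably terminal (`C_Π(1) = Π`);
  witness `Π = G = ℤ/2ℤ`, one cusp with `D = I = 1`;
* `not_lem_3_1_i_iff_iv_of_forall_not_isAlgebraic` / `not_forall_lem_3_1_i_iff_iv` — if the image of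
  a section IS the decomposition group of a point ((i) holds) but NO point is declared algebraic ((iv)
  fails at every level), the equivalence fails; witness the one-element extension, no cusps, one point;
* `not_cor_3_2_of_isEmpty` / `not_forall_cor_3_2` — an isomorphism cannot carry a nonempty set of
  decomposition groups onto an empty one; witness the one-element extension, `P` with one point, `Q`
  with none.

READING (honest framing): every statement here is about OUR typed interface — the predicates are not
true of ALL data, hence are HYPOTHESES ON DATA, to be consumed at the instances a curve model supplies
(the shape-(M) named facts `GalSect.Thm_1_3_ii_model`, `GalSect.Lem_3_1_model`, `GalSect.Cor_3_2_model`
of `CuspidalizationFactsModel.lean`, themselves relative to a `CurveModel`).  NOTHING in print is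
contradicted: Thm. 1.3 (ii), Lem. 3.1 and Cor. 3.2 are theorems about the étale fundamental groups of
hyperbolic curves over finite extensions of `ℚ_p`, objects the tree does not construct.  Refuted-as-schema
≠ refuted-in-print; no side taken on [IUTchIII] Cor. 3.12; typed ≠ proved.
-/

namespace Literature.AnabelianGeometry.AbsoluteAnabelian.GalSect

open _root_.Topology
open scoped Pointwise

universe u

variable {E F : FundamentalExtension.{u}}

/-! ## Two elementary group-theoretic facts -/

/-- The commensurator of the trivial subgroup is the whole group (every conjugate of `1` is `1`, and `1` is
commensurable with itself). [folklore] -/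
private theorem commensurator_bot (G : Type u) [Group G] :
    Subgroup.Commensurable.commensurator (⊥ : Subgroup G) = ⊤ := by
  refine eq_top_iff.mpr fun g _ => ?_
  simpa only [Subgroup.Commensurable.commensurator_mem_iff, Subgroup.smul_bot] using
    Subgroup.Commensurable.refl (⊥ : Subgroup G)

/-- In a nontrivial group the trivial subgroup is not commensurably terminal (`C_G(1) = G ≠ 1`).
[cite: MochizukiAbsAnab2004, Def 0.1 (iii) p.4] -/
theorem not_isCommensurablyTerminal_bot (G : Type u) [Group G] [Nontrivial G] :
    ¬ IsCommensurablyTerminal (⊥ : Subgroup G) := by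
  intro h
  have h' := h.commensurator_eq
  rw [commensurator_bot] at h'
  exact top_ne_bot h'

/-! ## F-0103: `GalSect.Thm_1_3_ii_cusps` -/

/-- If some cusp of the cuspidal data has TRIVIAL chosen decomposition group while `Π` is nontrivial, then
`Thm_1_3_ii_cusps C` fails (its first clause asks `D_x` to be commensurably terminal, but `C_Π(1) = Π`).
So the predicate is a genuine hypothesis on `C`. [cite: MochizukiGalSect2005, Thm 1.3 (ii) p.6] -/
theorem not_thm_1_3_ii_cusps_of_dcusp_eq_bot (C : E.CuspidalData) (x : C.Cusp) (hx : C.Dcusp x = ⊥)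
    [Nontrivial E.arith] :
    ¬ Literature.AnabelianGeometry.AbsoluteAnabelian.GalSect.Thm_1_3_ii_cusps C := by
  rintro ⟨h1, -⟩
  have h := h1 x
  rw [hx] at h
  exact not_isCommensurablyTerminal_bot E.arith h

/-- **FACT-LIST F-0103, universal closure REFUTED** (universe `0`): it is not the case that
`Thm_1_3_ii_cusps C` holds for every cuspidal datum `C` on every extension `E`.  Witness: the extension
`Π = G = ℤ/2ℤ` (finite discrete, `aug = id`, so `Δ = 1`) with ONE cusp whose decomposition and inertia
groups are trivial.  Thm. 1.3 (ii) itself (for the decomposition groups of cusps of a hyperbolic curve over a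
finite extension of `ℚ_p`) is not touched. [cite: MochizukiGalSect2005, Thm 1.3 (ii) p.6] -/
theorem not_forall_thm_1_3_ii_cusps :
    ¬ ∀ (E : FundamentalExtension.{0}) (C : E.CuspidalData),
      Literature.AnabelianGeometry.AbsoluteAnabelian.GalSect.Thm_1_3_ii_cusps C := by
  intro H
  let G : ProfiniteGrp.{0} := ProfiniteGrp.ofFiniteGrp (FiniteGrp.of (Multiplicative (ZMod 2)))
  have hG : Nontrivial (Multiplicative (ZMod 2)) :=
    ⟨⟨Multiplicative.ofAdd 0, Multiplicative.ofAdd 1,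
      Multiplicative.ofAdd.injective.ne (by decide : (0 : ZMod 2) ≠ 1)⟩⟩
  haveI : Nontrivial G := hG
  let E : FundamentalExtension.{0} :=
    { arith := G, gal := G, aug := ContinuousMonoidHom.id _, aug_surjective := Function.surjective_id }
  let C : E.CuspidalData :=
    { Cusp := PUnit
      Dcusp := fun _ => ⊥
      Icusp := fun _ => ⊥
      Icusp_eq := fun _ => (bot_inf_eq _).symm
      isClosed_Dcusp := fun _ => by
        rw [Subgroup.coe_bot]
        exact isClosed_singleton
      eq_of_conj := fun _ _ _ _ => rfl }
  exact not_thm_1_3_ii_cusps_of_dcusp_eq_bot C PUnit.unit rfl (H E C)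

/-- Instance form that DOES hold: cuspidal data WITHOUT cusps (the case of a proper curve) satisfy
`Thm_1_3_ii_cusps` vacuously. [cite: MochizukiGalSect2005, Thm 1.3 (ii) p.6] -/
theorem thm_1_3_ii_cusps_of_isEmpty (C : E.CuspidalData) [IsEmpty C.Cusp] :
    Literature.AnabelianGeometry.AbsoluteAnabelian.GalSect.Thm_1_3_ii_cusps C :=
  ⟨fun x => isEmptyElim x, fun x => isEmptyElim x⟩

/-! ## F-0101: `GalSect.Lem_3_1_i_iff_iv` -/

/-- If, for some characteristic tower and some section `σ` avoiding the cuspidal decomposition groups, the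
image of `σ` IS (a conjugate of) the decomposition group of a point of `P` — condition (i) — while NO point
of `P` is declared algebraic — so that condition (iv) fails at every level `j` — then `Lem_3_1_i_iff_iv C P`
fails.  So the predicate is a genuine hypothesis on `(C, P)` (in print, (i) ⇒ (iv) rests on the density of
the algebraic points among the `K`-rational points of the curve, a property the abstract `PointData` does
not carry). [cite: MochizukiGalSect2005, Lem 3.1 p.13] -/
theorem not_lem_3_1_i_iff_iv_of_forall_not_isAlgebraic (C : E.CuspidalData) (P : PointData E)
    (Δj : ℕ → Subgroup E.geom) (hΔ : IsCharacteristicTower E Δj)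
    (σ : E.gal →ₜ* E.arith) (hσ : ∀ g, E.aug (σ g) = g)
    (hcusp : ∀ (c : C.Cusp) (g : E.arith), ¬ σ.toMonoidHom.range ≤ MulAut.conj g • C.Dcusp c)
    (x₀ : P.Point) (g₀ : E.arith) (hx₀ : σ.toMonoidHom.range = MulAut.conj g₀ • P.decomp x₀)
    (halg : ∀ x, ¬ P.IsAlgebraic x) :
    ¬ Literature.AnabelianGeometry.AbsoluteAnabelian.GalSect.Lem_3_1_i_iff_iv C P := by
  intro H
  obtain ⟨x, -, hx, -⟩ := (H Δj hΔ σ hσ hcusp).mp ⟨x₀, g₀, hx₀⟩ 0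
  exact halg x hx

/-- **FACT-LIST F-0101, universal closure REFUTED** (universe `0`): it is not the case that
`Lem_3_1_i_iff_iv C P` holds for all cuspidal data `C` and point data `P` on every extension `E`.
Witness: the one-element extension `1 → 1 → 1 → 1 → 1` (finite discrete), the constant tower `Δ[j] = Δ = 1`
(characteristic, open, `⋂ = 1`), the identity section, NO cusps, and ONE point with decomposition group
`Π = Im(σ)` declared non-algebraic: (i) holds, (iv) fails.  Lem. 3.1 itself (for a hyperbolic curve over a
finite extension of `ℚ_p` defined over a number field) is not touched. [cite: MochizukiGalSect2005, Lem 3.1 p.13] -/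
theorem not_forall_lem_3_1_i_iff_iv :
    ¬ ∀ (E : FundamentalExtension.{0}) (C : E.CuspidalData) (P : PointData E),
      Literature.AnabelianGeometry.AbsoluteAnabelian.GalSect.Lem_3_1_i_iff_iv C P := by
  intro H
  let G : ProfiniteGrp.{0} := ProfiniteGrp.ofFiniteGrp (FiniteGrp.of PUnit.{1})
  let E : FundamentalExtension.{0} :=
    { arith := G, gal := G, aug := ContinuousMonoidHom.id _, aug_surjective := Function.surjective_id }
  let C : E.CuspidalData :=
    { Cusp := PEmpty
      Dcusp := fun c => nomatch c
      Icusp := fun c => nomatch c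
      Icusp_eq := fun c => nomatch c
      isClosed_Dcusp := fun c => nomatch c
      eq_of_conj := fun c => nomatch c }
  let σ : E.gal →ₜ* E.arith := ContinuousMonoidHom.id _
  let P : PointData E :=
    { Point := PUnit
      decomp := fun _ => σ.toMonoidHom.range
      isClosed_decomp := fun _ => by
        rw [MonoidHom.coe_range]
        exact (isCompact_range (map_continuous σ)).isClosed
      IsAlgebraic := fun _ => False }
  let Δj : ℕ → Subgroup E.geom := fun _ => ⊤
  have hΔ : IsCharacteristicTower E Δj :=
    { antitone := fun _ _ _ => le_rfl
      isOpen := fun _ => by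
        change IsOpen ((⊤ : Subgroup E.geom) : Set E.geom)
        rw [Subgroup.coe_top]
        exact isOpen_univ
      characteristic := fun _ φ => Subgroup.map_top_of_surjective _ φ.surjective
      iInf_eq_bot := by
        change (⨅ _ : ℕ, (⊤ : Subgroup E.geom)) = ⊥
        rw [iInf_top]
        refine (Subgroup.eq_bot_iff_forall _).mpr fun x _ => Subtype.ext ?_
        change (x : E.arith) = 1
        exact (E.mem_geom).mp x.2 }
  refine not_lem_3_1_i_iff_iv_of_forall_not_isAlgebraic C P Δj hΔ σ (fun _ => rfl)
    (fun c => nomatch c) PUnit.unit 1 ?_ (fun _ h => h) (H E C P)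
  change σ.toMonoidHom.range = MulAut.conj (1 : E.arith) • σ.toMonoidHom.range
  rw [map_one, one_smul]

/-! ## F-0100: `GalSect.Cor_3_2` -/

/-- If `P` has a point and `Q` has none, then no map carries the (nonempty) set of decomposition groups of
`P` onto the (empty) one of `Q`; given any isomorphism `α : Π_E ⥲ Π_F`, `Cor_3_2 P Q` fails.  So the predicate
is a genuine hypothesis on `(P, Q)`. [cite: MochizukiGalSect2005, Cor 3.2 p.14] -/
theorem not_cor_3_2_of_isEmpty (P : PointData E) (Q : PointData F) [Nonempty P.Point] [IsEmpty Q.Point]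
    (α : E.arith ≃ₜ* F.arith) :
    ¬ Literature.AnabelianGeometry.AbsoluteAnabelian.GalSect.Cor_3_2 P Q := by
  intro H
  obtain ⟨x⟩ := ‹Nonempty P.Point›
  have hmem : (P.decomp x).map α.toMonoidHom ∈
      (fun D : Subgroup E.arith => D.map α.toMonoidHom) '' P.decompositionGroups :=
    ⟨P.decomp x, ⟨x, 1, by rw [map_one, one_smul]⟩, rfl⟩
  rw [H α] at hmem
  obtain ⟨y, -, -⟩ := hmem
  exact IsEmpty.false y

/-- **FACT-LIST F-0100, universal closure REFUTED** (universe `0`): it is not the case that `Cor_3_2 P Q`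
holds for all point data `P`, `Q` on all extensions `E`, `F`.  Witness: `E = F =` the one-element extension,
`α = id`, `P` with ONE point (decomposition group `1`), `Q` with NO point.  Cor. 3.2 itself (for hyperbolic
curves over finite extensions of `ℚ_p`, defined over number fields and isogenous to genus zero) is not
touched. [cite: MochizukiGalSect2005, Cor 3.2 p.14] -/
theorem not_forall_cor_3_2 :
    ¬ ∀ (E F : FundamentalExtension.{0}) (P : PointData E) (Q : PointData F),
      Literature.AnabelianGeometry.AbsoluteAnabelian.GalSect.Cor_3_2 P Q := by
  intro H
  let G : ProfiniteGrp.{0} := ProfiniteGrp.ofFiniteGrp (FiniteGrp.of PUnit.{1})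
  let E : FundamentalExtension.{0} :=
    { arith := G, gal := G, aug := ContinuousMonoidHom.id _, aug_surjective := Function.surjective_id }
  let P : PointData E :=
    { Point := PUnit
      decomp := fun _ => ⊥
      isClosed_decomp := fun _ => by
        rw [Subgroup.coe_bot]
        exact isClosed_singleton
      IsAlgebraic := fun _ => True }
  let Q : PointData E :=
    { Point := PEmpty
      decomp := fun c => nomatch c
      isClosed_decomp := fun c => nomatch c
      IsAlgebraic := fun c => nomatch c }
  haveI : Nonempty P.Point := ⟨PUnit.unit⟩
  haveI : IsEmpty Q.Point := inferInstanceAs (IsEmpty PEmpty)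
  exact not_cor_3_2_of_isEmpty P Q (ContinuousMulEquiv.refl _) (H E E P Q)

end Literature.AnabelianGeometry.AbsoluteAnabelian.GalSect
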